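import Literature.AlgebraicGeometry.RelativeSpec.GeometricQuotientRecognition
import Mathlib.AlgebraicGeometry.Morphisms.Flat
import Mathlib.Algebra.Category.Ring.Constructions
import Mathlib.RingTheory.Flat.Basic
import Mathlib.LinearAlgebra.TensorProduct.Pi
import HarnessLib

/-!
# Geometric quotients by finite groups commute with flat base change (SGA 1, Exp. V, Prop. 1.9)

SGA 1, Exp. V, Prop. 1.9: «la formation du quotient `X/G` commute au changement de base plat
`Y′ → Y`». Let a finite group `G` act on a scheme `X` (over some base, `RelativeSpec.ActionOver`) and
let `p : X → Q` be an AFFINE geometric quotient in the sense of Mumford's conditions (1), (2)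
(`ActionOver.IsGeometricQuotient`; e.g. the tree's `X → X/G`, `isGeometricQuotient_gluedMk`, or any
`finiteQuotient.mk`). For a FLAT morphism `f : Y′ → Q` and a cartesian square
`f′ : X′ → X`, `p′ : X′ → Y′` (`IsPullback f′ p′ p f`), with `G` acting on `X′` over `Y′` compatibly
with `f′` (the base-changed action, presented by `hρ′ : g′ ≫ f′ = f′ ≫ g`), the base change
`p′ : X′ → Y′` is again a geometric quotient of `X′` by `G`
(`ActionOver.isGeometricQuotient_baseChange_of_flat`). The FIELD case `Y′ = Spec K → Spec k = Q`-base
(★ `ActionOver.isGeometricQuotient_baseChange`, `GeometricQuotientBaseChange.lean`) is the special case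
`f = Q ×_k Spec K → Q`; this file removes the restriction to base-field extensions and allows an
arbitrary flat `Y′ → Q` (open immersions, étale neighbourhoods, flat covers, generic points
`Spec 𝒪_{Q,η} → Q`, …), which is the form used in [MumfordFogartyKirwan1994] Ch. 0 §2 Def. 0.7
(«uniform categorical/geometric quotient») and in SGA 1 V §1.

Proof (affine-locally on `Y′` over affine opens of `Q`, then recognition
★ `ActionOver.isGeometricQuotient_of_range_app`): for affine opens `W ⊆ Y′`, `V ⊆ Q` with `f(W) ⊆ V`
the rings of sections `R = Γ(Q, V)`, `A = Γ(X, p⁻¹V)`, `B = Γ(Y′, W)`, `A′ = Γ(X′, p′⁻¹W)` form a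
cocartesian square `A′ = B ⊗_R A` (Mathlib `isIso_pushoutSection_of_isAffineOpen`), `B` is flat over `R`
(Mathlib `Scheme.Hom.flat_appLE`), `R → A` is injective with image `A^G` (Mumford's (2) for `p`), and
flat base change preserves both facts: `B → B ⊗_R A` is injective
(`injective_of_isBaseChange_of_flat`) and `(B ⊗_R A)^G = B · (1 ⊗ A^G)` because the exact sequence
`0 → A^G → A → ∏_{g ∈ G} A`, `a ↦ (g·a − a)_g`, stays exact after `B ⊗_R –`
(`setOf_forall_eq_span_image_of_isBaseChange_of_flat`, Mathlib `Module.Flat.lTensor_exact` and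
`TensorProduct.piRight` for the FINITE product).

* `injective_of_isBaseChange_of_flat` — injectivity survives base change to a flat algebra;
* `setOf_forall_eq_span_image_of_isBaseChange_of_flat` — joint equalisers of finitely many pairs of
  operators commute with flat base change («invariants commute with flat extension of scalars»);
* `ActionOver.injective_app_and_range_app_baseChange_of_flat` — Mumford's (2) for `p′` on the affine
  opens of `Y′` lying over affine opens of `Q`;
* `ActionOver.isGeometricQuotient_baseChange_of_flat` — the theorem;
* `ActionOver.existsUnique_desc_baseChange_of_flat` — consequently `p′` is a categorical quotient for
  separated targets.

Everything is proved; no named facts and no definitions.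

Mathlib searched (pin): `isIso_pushoutSection_of_isAffineOpen`, `isIso_pushoutSection_iff`,
`Scheme.Hom.flat_appLE`, `CommRingCat.isPushout_iff_isPushout`, `Algebra.IsPushout.out`,
`IsBaseChange.equiv`, `IsBaseChange.linearMap`, `Module.Flat.lTensor_exact`,
`Module.Flat.lTensor_preserves_injective_linearMap`, `TensorProduct.piRight`,
`LinearMap.exact_subtype_ker_map`, `MorphismProperty.IsStableUnderBaseChange.of_isPullback`,
`Scheme.isBasis_affineOpens` (all used); Mathlib has no quotients of schemes by finite groups.

## References

* A. Grothendieck, *SGA 1*, Exp. V, §1, Prop. 1.9 (quotients commute with flat base change). [SGA1]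
* D. Mumford, J. Fogarty, F. Kirwan, *Geometric Invariant Theory*, 3rd ed. (1994), Ch. 0 §2,
  Def. 0.7 (uniform / universal categorical and geometric quotients). [MumfordFogartyKirwan1994]
* D. Mumford, *Abelian Varieties* (1970), §7, Theorem p. 66 and Remark. [MumfordAV1970]
-/

noncomputable section

universe u

open CategoryTheory Limits AlgebraicGeometry Opposite TensorProduct

namespace Literature.AlgebraicGeometry.RelativeSpec

/-! ### Linear algebra of base change along a flat algebra -/

section Algebra

variable {R B : Type*} [CommRing R] [CommRing B] [Algebra R B]
  {M N M₂ N₂ : Type*} [AddCommGroup M] [Module R M] [AddCommGroup N] [Module R N] [Module B N]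
  [IsScalarTower R B N] [AddCommGroup M₂] [Module R M₂] [AddCommGroup N₂] [Module R N₂] [Module B N₂]
  [IsScalarTower R B N₂] {j₁ : M →ₗ[R] N} {j₂ : M₂ →ₗ[R] N₂}

/-- A `B`-linear map extending an `R`-linear map along base changes is `1 ⊗ φ` transported along
the identifications `B ⊗_R M ≅ N`, `B ⊗_R M₂ ≅ N₂`. [folklore] -/
private theorem apply_equiv_eq_of_isBaseChange (h₁ : IsBaseChange B j₁) (h₂ : IsBaseChange B j₂)
    (φ : M →ₗ[R] M₂) (φ' : N →ₗ[B] N₂) (hc : ∀ x, φ' (j₁ x) = j₂ (φ x)) (z : B ⊗[R] M) :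
    φ' (h₁.equiv z) = h₂.equiv (φ.lTensor B z) := by
  induction z using TensorProduct.induction_on with
  | zero => simp
  | tmul c m => rw [LinearMap.lTensor_tmul, h₁.equiv_tmul, h₂.equiv_tmul, map_smul, hc]
  | add x y hx hy => rw [map_add, map_add, hx, hy, map_add, map_add]

/-- **Injectivity survives base change to a flat algebra**: if `φ' : N → N₂` is `B`-linear and
extends the injective `R`-linear `φ : M → M₂` along base changes `j₁ : M → N`, `j₂ : M₂ → N₂` to the
FLAT `R`-algebra `B`, then `φ'` (`≅ 1_B ⊗ φ`) is injective. [cite: SGA1, Exp. V Prop. 1.9 (proof)] -/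
theorem injective_of_isBaseChange_of_flat [Module.Flat R B] (h₁ : IsBaseChange B j₁)
    (h₂ : IsBaseChange B j₂) (φ : M →ₗ[R] M₂) (φ' : N →ₗ[B] N₂) (hc : ∀ x, φ' (j₁ x) = j₂ (φ x))
    (hφ : Function.Injective φ) : Function.Injective φ' := by
  intro x y hxy
  obtain ⟨z, rfl⟩ := h₁.equiv.surjective x
  obtain ⟨w, rfl⟩ := h₁.equiv.surjective y
  rw [apply_equiv_eq_of_isBaseChange h₁ h₂ φ φ' hc, apply_equiv_eq_of_isBaseChange h₁ h₂ φ φ' hc] at hxy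
  rw [Module.Flat.lTensor_preserves_injective_linearMap φ hφ (h₂.equiv.injective hxy)]

/-- **Joint equalisers commute with flat base change** («invariants commute with flat extension of
scalars», the algebra of SGA 1 V 1.9): for a base change `j : M → N` of `R`-modules to a FLAT
`R`-algebra `B`, FINITELY many pairs of `R`-linear operators `Sᵢ, Tᵢ` on `M` with `B`-linear
extensions `S'ᵢ, T'ᵢ` on `N`, the joint equaliser `{y | ∀ i, S'ᵢ y = T'ᵢ y}` is the `B`-span of the
image of `{x | ∀ i, Sᵢ x = Tᵢ x}`.  Proof: `0 → E → M → ∏ᵢ M`, `x ↦ (Sᵢ x − Tᵢ x)ᵢ`, is exact, stays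
exact after `B ⊗_R –` (flatness), and `B ⊗_R ∏ᵢ M = ∏ᵢ (B ⊗_R M)` for a finite product.  (The field
case, for arbitrary families, is ★ `Motives.setOf_forall_eq_span_image_of_isBaseChange`.)
[cite: SGA1, Exp. V Prop. 1.9 (proof)] -/
theorem setOf_forall_eq_span_image_of_isBaseChange_of_flat [Module.Flat R B] (hj : IsBaseChange B j₁)
    {ι : Type*} [Finite ι] (S T : ι → M →ₗ[R] M) (S' T' : ι → N →ₗ[B] N)
    (hS : ∀ i x, S' i (j₁ x) = j₁ (S i x)) (hT : ∀ i x, T' i (j₁ x) = j₁ (T i x)) :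
    {y : N | ∀ i, S' i y = T' i y} = Submodule.span B (j₁ '' {x | ∀ i, S i x = T i x}) := by
  classical
  cases nonempty_fintype ι
  apply Set.Subset.antisymm
  · intro y hy
    -- the difference map `δ : M → ∏ᵢ M` and the exact sequence `0 → ker δ → M → ∏ᵢ M`
    let δ : M →ₗ[R] (ι → M) := LinearMap.pi fun i => S i - T i
    have hE : ∀ x : M, x ∈ LinearMap.ker δ ↔ ∀ i, S i x = T i x := fun x => by
      simp only [δ, LinearMap.mem_ker, funext_iff, LinearMap.pi_apply, LinearMap.sub_apply,
        Pi.zero_apply, sub_eq_zero]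
    have hexB := Module.Flat.lTensor_exact B (LinearMap.exact_subtype_ker_map δ)
    obtain ⟨z, rfl⟩ := hj.equiv.surjective y
    -- `(1 ⊗ δ) z = 0`, read componentwise through `B ⊗ ∏ᵢ M = ∏ᵢ (B ⊗ M)`
    have hcomp : ∀ (w : B ⊗[R] M) (i : ι),
        TensorProduct.piRight R B B (fun _ : ι => M) (δ.lTensor B w) i = (S i - T i).lTensor B w := by
      intro w i
      induction w using TensorProduct.induction_on with
      | zero => simp
      | tmul b m => simp [δ, TensorProduct.tmul_sub]
      | add x y hx hy => simp only [map_add, Pi.add_apply, hx, hy]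
    have hz : δ.lTensor B z = 0 := by
      apply (TensorProduct.piRight R B B (fun _ : ι => M)).injective
      rw [map_zero]
      funext i
      rw [hcomp, Pi.zero_apply]
      apply hj.equiv.injective
      rw [map_zero, ← apply_equiv_eq_of_isBaseChange hj hj (S i - T i) (S' i - T' i)
        (fun x => by rw [LinearMap.sub_apply, LinearMap.sub_apply, hS, hT, map_sub]),
        LinearMap.sub_apply, sub_eq_zero]
      exact hy i
    obtain ⟨w, hw⟩ := (hexB z).mp hz
    rw [← hw]
    clear hw hz
    induction w using TensorProduct.induction_on with
    | zero => rw [map_zero, map_zero]; exact Submodule.zero_mem _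
    | tmul b e =>
      rw [LinearMap.lTensor_tmul, hj.equiv_tmul]
      exact Submodule.smul_mem _ b (Submodule.subset_span ⟨e, (hE e).mp e.2, rfl⟩)
    | add x y hx hy => rw [map_add, map_add]; exact Submodule.add_mem _ hx hy
  · have h : Submodule.span B (j₁ '' {x | ∀ i, S i x = T i x}) ≤
        ⨅ i, LinearMap.eqLocus (S' i) (T' i) := by
      rw [Submodule.span_le]
      rintro _ ⟨x, hx, rfl⟩
      simp only [SetLike.mem_coe, Submodule.mem_iInf, LinearMap.mem_eqLocus]
      intro i
      rw [hS, hT, hx i]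
    intro y hy
    have hy' := h hy
    simp only [Submodule.mem_iInf, LinearMap.mem_eqLocus] at hy'
    exact hy'

end Algebra

/-! ### Sections along commutative triangles -/

section Sections

/-- Pointwise `f♯ (g♯ s) = h♯ s` on compatible opens when `f ≫ g = h`. [folklore] -/
private theorem appLE_appLE_apply_of_comp_eq {X Y Z : Scheme.{u}} {f : X ⟶ Y} {g : Y ⟶ Z} {h : X ⟶ Z}
    (e : f ≫ g = h) (U : Z.Opens) (V : Y.Opens) (W : X.Opens) (hV : V ≤ g ⁻¹ᵁ U) (hW : W ≤ f ⁻¹ᵁ V)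
    (hW' : W ≤ h ⁻¹ᵁ U) (s : Γ(Z, U)) :
    f.appLE V W hW (g.appLE U V hV s) = h.appLE U W hW' s := by
  subst e
  rw [← CommRingCat.comp_apply, Scheme.Hom.appLE_comp_appLE]

end Sections

/-! ### The theorem -/

namespace ActionOver

variable {X Y Q X' Y' : Scheme.{u}} {r : X ⟶ Y} {p : X ⟶ Q} {f : Y' ⟶ Q} {p' : X' ⟶ Y'}
  {f' : X' ⟶ X} {G : Type*} [Group G] (ρ : ActionOver r G)

set_option backward.isDefEq.respectTransparency false

/-- **Mumford's condition (2) after a flat base change, on the affine opens of `Y′` over affine opens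
of `Q`.**  For an affine geometric quotient `p : X → Q`, a flat `f : Y′ → Q`, a cartesian square
`(f′, p′)` over `(p, f)` with the compatible action on `X′`, and affine opens `W ⊆ Y′`, `V ⊆ Q` with
`W ⊆ f⁻¹V`: `p′♯ : Γ(Y′, W) → Γ(X′, p′⁻¹W)` is injective with image the `G`-invariants.  The four rings
of sections form the cocartesian square `Γ(X′, p′⁻¹W) = Γ(Y′, W) ⊗_{Γ(Q,V)} Γ(X, p⁻¹V)`
(`isIso_pushoutSection_of_isAffineOpen`), `Γ(Y′, W)` is flat over `Γ(Q, V)` (`Scheme.Hom.flat_appLE`),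
and flat base change preserves injectivity of `p♯` (`injective_of_isBaseChange_of_flat`) and the
invariants (`setOf_forall_eq_span_image_of_isBaseChange_of_flat`).
[cite: SGA1, Exp. V Prop. 1.9] [cite: MumfordAV1970, §7 Thm. p. 66 (2)] -/
theorem injective_app_and_range_app_baseChange_of_flat [Finite G] (hq : ρ.IsGeometricQuotient p)
    [IsAffineHom p] [Flat f] (H : IsPullback f' p' p f) (ρ' : ActionOver p' G)
    (hρ' : ∀ g : G, (ρ'.aut g).hom ≫ f' = f' ≫ (ρ.aut g).hom)
    (V : Q.affineOpens) (W : Y'.affineOpens) (hWV : (W : Y'.Opens) ≤ f ⁻¹ᵁ (V : Q.Opens)) :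
    Function.Injective (p'.app W.1) ∧
      Set.range (p'.app W.1) = {s | ∀ g : G, ρ'.act g W.1 s = s} := by
  -- the four affine opens
  let A₀ : X.Opens := p ⁻¹ᵁ V.1
  have hA₀ : IsAffineOpen A₀ := V.2.preimage p
  let A₁ : X'.Opens := p' ⁻¹ᵁ W.1
  have hA₁le : A₁ ≤ f' ⁻¹ᵁ A₀ := by
    change p' ⁻¹ᵁ W.1 ≤ f' ⁻¹ᵁ (p ⁻¹ᵁ V.1)
    rw [← Scheme.Hom.comp_preimage, H.w, Scheme.Hom.comp_preimage]
    exact p'.preimage_mono hWV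
  have hA₁ : A₁ = f' ⁻¹ᵁ A₀ ⊓ p' ⁻¹ᵁ W.1 := le_antisymm (le_inf hA₁le le_rfl) inf_le_right
  -- stability of the opens under the actions
  have eA₀ : ∀ g : G, A₀ ≤ (ρ.aut g).hom ⁻¹ᵁ A₀ := ρ.preimage_le_aut_preimage p hq.comp_eq V.1
  have eA₁ : ∀ g : G, A₁ ≤ (ρ'.aut g).hom ⁻¹ᵁ A₁ := fun g => (ρ'.preimage_preimage g W.1).ge
  -- the cocartesian square of sections `Γ(X', A₁) = Γ(Y', W) ⊗_{Γ(Q, V)} Γ(X, A₀)`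
  have PX := (isIso_pushoutSection_iff H hWV (le_refl A₀) hA₁).mp
    (isIso_pushoutSection_of_isAffineOpen H hWV (le_refl A₀) hA₁ V.2 W.2 hA₀)
  -- algebra structures: `R₀ = Γ(Q, V)`, `A = Γ(X, A₀)`, `B = Γ(Y', W)`, `A' = Γ(X', A₁)`
  letI algA : Algebra Γ(Q, V.1) Γ(X, A₀) := (p.appLE V.1 A₀ le_rfl).hom.toAlgebra
  letI algB : Algebra Γ(Q, V.1) Γ(Y', W.1) := (f.appLE V.1 W.1 hWV).hom.toAlgebra
  letI algAA' : Algebra Γ(X, A₀) Γ(X', A₁) := (f'.appLE A₀ A₁ hA₁le).hom.toAlgebra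
  letI algBA' : Algebra Γ(Y', W.1) Γ(X', A₁) := (p'.appLE W.1 A₁ le_rfl).hom.toAlgebra
  letI alg0A' : Algebra Γ(Q, V.1) Γ(X', A₁) :=
    ((algebraMap Γ(Y', W.1) Γ(X', A₁)).comp (algebraMap Γ(Q, V.1) Γ(Y', W.1))).toAlgebra
  haveI : IsScalarTower Γ(Q, V.1) Γ(Y', W.1) Γ(X', A₁) := IsScalarTower.of_algebraMap_eq' rfl
  haveI : IsScalarTower Γ(Q, V.1) Γ(X, A₀) Γ(X', A₁) :=
    IsScalarTower.of_algebraMap_eq' (RingHom.ext fun c => by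
      have h := ConcreteCategory.congr_hom PX.w c
      exact h.symm)
  have hP : Algebra.IsPushout Γ(Q, V.1) Γ(Y', W.1) Γ(X, A₀) Γ(X', A₁) :=
    CommRingCat.isPushout_iff_isPushout.mp PX.flip
  have hj := hP.out
  -- flatness of `B` over `R₀`
  haveI : Module.Flat Γ(Q, V.1) Γ(Y', W.1) := f.flat_appLE V.2 W.2 hWV
  -- (i) injectivity of `p'♯ = algebraMap B A'`
  have hinj : Function.Injective (algebraMap Γ(Y', W.1) Γ(X', A₁)) := by
    have h := injective_of_isBaseChange_of_flat (IsBaseChange.linearMap Γ(Q, V.1) Γ(Y', W.1)) hj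
      (Algebra.linearMap Γ(Q, V.1) Γ(X, A₀)) (Algebra.linearMap Γ(Y', W.1) Γ(X', A₁))
      (fun c => by
        change algebraMap Γ(Y', W.1) Γ(X', A₁) (algebraMap Γ(Q, V.1) Γ(Y', W.1) c) =
          algebraMap Γ(X, A₀) Γ(X', A₁) (algebraMap Γ(Q, V.1) Γ(X, A₀) c)
        rw [← IsScalarTower.algebraMap_apply, ← IsScalarTower.algebraMap_apply])
      (by
        change Function.Injective (p.appLE V.1 A₀ le_rfl)
        rw [← Scheme.Hom.app_eq_appLE]
        exact hq.app_injective V.1)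
    exact h
  -- the actions as algebra maps
  have hLc : ∀ (g : G) (c : Γ(Q, V.1)),
      ρ.actOn A₀ eA₀ g (algebraMap Γ(Q, V.1) Γ(X, A₀) c) = algebraMap Γ(Q, V.1) Γ(X, A₀) c := fun g c => by
    change ρ.actOn (p ⁻¹ᵁ V.1) eA₀ g (p.appLE V.1 A₀ le_rfl c) = p.appLE V.1 A₀ le_rfl c
    rw [← Scheme.Hom.app_eq_appLE]
    exact ρ.actOn_app p hq.comp_eq g V.1 c
  let L : G → (Γ(X, A₀) →ₐ[Γ(Q, V.1)] Γ(X, A₀)) := fun g =>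
    { toRingHom := ρ.actOn A₀ eA₀ g, commutes' := hLc g }
  have hL'c : ∀ (g : G) (b : Γ(Y', W.1)),
      ρ'.act g W.1 (algebraMap Γ(Y', W.1) Γ(X', A₁) b) = algebraMap Γ(Y', W.1) Γ(X', A₁) b := fun g b => by
    change ρ'.act g W.1 (p'.appLE W.1 A₁ le_rfl b) = p'.appLE W.1 A₁ le_rfl b
    rw [← Scheme.Hom.app_eq_appLE]
    exact ρ'.act_app g W.1 b
  let L' : G → (Γ(X', A₁) →ₐ[Γ(Y', W.1)] Γ(X', A₁)) := fun g =>
    { toRingHom := ρ'.act g W.1, commutes' := hL'c g }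
  -- compatibility of the actions with `f'♯ : A → A'`
  have hA₁le' : ∀ g : G, A₁ ≤ ((ρ'.aut g⁻¹).hom ≫ f') ⁻¹ᵁ A₀ := fun g => by
    rw [Scheme.Hom.comp_preimage]
    exact (eA₁ g⁻¹).trans ((ρ'.aut g⁻¹).hom.preimage_mono hA₁le)
  have hLL' : ∀ (g : G) (a : Γ(X, A₀)),
      (L' g).toLinearMap ((IsScalarTower.toAlgHom Γ(Q, V.1) Γ(X, A₀) Γ(X', A₁)).toLinearMap a) =
        (IsScalarTower.toAlgHom Γ(Q, V.1) Γ(X, A₀) Γ(X', A₁)).toLinearMap ((L g).toLinearMap a) :=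
    fun g a => by
    change ρ'.act g W.1 (f'.appLE A₀ A₁ hA₁le a) = f'.appLE A₀ A₁ hA₁le (ρ.actOn A₀ eA₀ g a)
    rw [act_apply, actOn_apply,
      appLE_appLE_apply_of_comp_eq rfl A₀ A₁ A₁ hA₁le (eA₁ g⁻¹) (hA₁le' g),
      appLE_appLE_apply_of_comp_eq (hρ' g⁻¹).symm A₀ A₀ A₁ (eA₀ g⁻¹) hA₁le (hA₁le' g)]
  -- invariants commute with the flat base change
  have key := setOf_forall_eq_span_image_of_isBaseChange_of_flat hj
    (fun g => (L g).toLinearMap) (fun _ => (LinearMap.id : Γ(X, A₀) →ₗ[Γ(Q, V.1)] Γ(X, A₀)))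
    (fun g => (L' g).toLinearMap) (fun _ => (LinearMap.id : Γ(X', A₁) →ₗ[Γ(Y', W.1)] Γ(X', A₁)))
    hLL' (fun _ _ => rfl)
  -- Mumford's (2) for `p` on `V`
  have hrange : Set.range (p.app V.1) =
      {x | ∀ g : G, (L g).toLinearMap x = (LinearMap.id : Γ(X, A₀) →ₗ[Γ(Q, V.1)] Γ(X, A₀)) x} :=
    hq.range_app V.1
  refine ⟨?_, Set.Subset.antisymm ?_ ?_⟩
  · rw [Scheme.Hom.app_eq_appLE]
    exact hinj
  · rintro _ ⟨b, rfl⟩ g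
    exact ρ'.act_app g W.1 b
  · intro s hs
    have hs' : s ∈ {y : Γ(X', A₁) | ∀ g : G,
        (L' g).toLinearMap y = (LinearMap.id : Γ(X', A₁) →ₗ[Γ(Y', W.1)] Γ(X', A₁)) y} := hs
    rw [key] at hs'
    have hle : Submodule.span Γ(Y', W.1)
        ((IsScalarTower.toAlgHom Γ(Q, V.1) Γ(X, A₀) Γ(X', A₁)).toLinearMap ''
          {x | ∀ g : G, (L g).toLinearMap x = (LinearMap.id : Γ(X, A₀) →ₗ[Γ(Q, V.1)] Γ(X, A₀)) x}) ≤
        LinearMap.range (Algebra.linearMap Γ(Y', W.1) Γ(X', A₁)) := by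
      rw [Submodule.span_le]
      rintro _ ⟨x, hx, rfl⟩
      rw [← hrange] at hx
      obtain ⟨c, rfl⟩ := hx
      refine ⟨algebraMap Γ(Q, V.1) Γ(Y', W.1) c, ?_⟩
      change algebraMap Γ(Y', W.1) Γ(X', A₁) (algebraMap Γ(Q, V.1) Γ(Y', W.1) c) =
        algebraMap Γ(X, A₀) Γ(X', A₁) (p.app V.1 c)
      rw [Scheme.Hom.app_eq_appLE]
      change _ = algebraMap Γ(X, A₀) Γ(X', A₁) (algebraMap Γ(Q, V.1) Γ(X, A₀) c)
      rw [← IsScalarTower.algebraMap_apply, ← IsScalarTower.algebraMap_apply]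
    obtain ⟨b, hb⟩ := hle hs'
    refine ⟨b, ?_⟩
    rw [Scheme.Hom.app_eq_appLE]
    exact hb

/-- **Geometric quotients by finite groups commute with flat base change** (SGA 1, Exp. V,
Prop. 1.9).  Let the finite group `G` act on `X` (over any base `r : X → Y`), let `p : X → Q` be an
AFFINE geometric quotient (Mumford's (1), (2); e.g. the tree's `X → X/G`), let `f : Y′ → Q` be FLAT,
and let `f′ : X′ → X`, `p′ : X′ → Y′` be a cartesian square over `p`, `f` (`IsPullback f′ p′ p f`;
e.g. `pullback.fst`/`pullback.snd`), with an action of `G` on `X′` over `Y′` compatible with `f′`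
(the base-changed action).  Then `p′` is a geometric quotient of `X′` by `G`.  The field case
`Y′ = Q_K` is ★ `isGeometricQuotient_baseChange`. [cite: SGA1, Exp. V Prop. 1.9]
[cite: MumfordFogartyKirwan1994, Ch. 0 §2 Def. 0.7] [cite: MumfordAV1970, §7 Thm. p. 66] -/
theorem isGeometricQuotient_baseChange_of_flat [Finite G] (hq : ρ.IsGeometricQuotient p)
    [IsAffineHom p] [Flat f] (H : IsPullback f' p' p f) (ρ' : ActionOver p' G)
    (hρ' : ∀ g : G, (ρ'.aut g).hom ≫ f' = f' ≫ (ρ.aut g).hom) : ρ'.IsGeometricQuotient p' := by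
  haveI : IsAffineHom p' := MorphismProperty.IsStableUnderBaseChange.of_isPullback H inferInstance
  -- the affine opens of `Y'` lying over affine opens of `Q`
  let ι := {i : Y'.affineOpens × Q.affineOpens // (i.1 : Y'.Opens) ≤ f ⁻¹ᵁ (i.2 : Q.Opens)}
  refine ρ'.isGeometricQuotient_of_range_app (fun i : ι => i.1.1) ?_
    (fun i => (ρ.injective_app_and_range_app_baseChange_of_flat hq H ρ' hρ' i.1.2 i.1.1 i.2).1)
    (fun i => (ρ.injective_app_and_range_app_baseChange_of_flat hq H ρ' hρ' i.1.2 i.1.1 i.2).2)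
  rw [eq_top_iff]
  rintro y -
  obtain ⟨V, hyV⟩ : ∃ V : Q.affineOpens, f y ∈ (V : Q.Opens) := by
    have h : f y ∈ (⊤ : Q.Opens) := trivial
    rw [← iSup_affineOpens_eq_top Q, TopologicalSpace.Opens.mem_iSup] at h
    exact h
  obtain ⟨W, hW, hyW, hWV⟩ :=
    (TopologicalSpace.Opens.isBasis_iff_nbhd.mp Y'.isBasis_affineOpens) (show y ∈ f ⁻¹ᵁ V.1 from hyV)
  exact TopologicalSpace.Opens.mem_iSup.mpr ⟨⟨(⟨W, hW⟩, V), hWV⟩, hyW⟩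

/-- **Universal property after flat base change**: under the hypotheses of
`isGeometricQuotient_baseChange_of_flat`, every `G`-invariant morphism from `X′` to a separated scheme
factors uniquely through `p′` (★ `IsGeometricQuotient.existsUnique_desc`) — `p′` is a categorical
quotient, i.e. `p` is a UNIFORM categorical quotient in the sense of [MumfordFogartyKirwan1994]
Def. 0.7 for flat base changes. [cite: SGA1, Exp. V Prop. 1.9] [cite: MumfordFogartyKirwan1994, Ch. 0 §2 Def. 0.7] -/
theorem existsUnique_desc_baseChange_of_flat [Finite G] (hq : ρ.IsGeometricQuotient p)
    [IsAffineHom p] [Flat f] (H : IsPullback f' p' p f) (ρ' : ActionOver p' G)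
    (hρ' : ∀ g : G, (ρ'.aut g).hom ≫ f' = f' ≫ (ρ.aut g).hom)
    {Z : Scheme.{u}} [Z.IsSeparated] (φ : X' ⟶ Z) (hφ : ∀ g : G, (ρ'.aut g).hom ≫ φ = φ) :
    ∃! ψ : Y' ⟶ Z, p' ≫ ψ = φ :=
  (ρ.isGeometricQuotient_baseChange_of_flat hq H ρ' hρ').existsUnique_desc φ hφ

end ActionOver

end Literature.AlgebraicGeometry.RelativeSpec

end
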